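import Summits.Ventures.PercRepro.RankLevelSetExplicitLin2KeyL

/-!
# PercRepro — THE LEVEL-10 THEOREM-M ROW OF C-025: THE KEY AT `p = 1 212` (p4, S4 feed)

`proofs/P4-gen18.md`. With THEOREM M's staircase multiplicity the assembled inequality `(P_d)` holds, exactly evaluated, at EVERY
core corank `11 ≤ d ≤ 1034` from `p = 1 089` (it fails at `p = 1 088`, corank `11`; the quartic floor is `2 126`, the
saturated one `8 710`). The row is taken at `p = 1 212` = the Chernoff tail `⌈(9(10 + 2^10) + 17·10 + 216)/8⌉` of
RankLevelSetExplicitLin2LevelTail, which now binds: the key `KeyL 10 1212 d` (RankLevelSetExplicitLin2KeyL) is checked by the kernel at the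
1 024 coranks (`decide`, 1 chunk of 1 024). The level step and the unconditional chain are
RankLevelSetExplicitLin2IndepFloor (`c025_ten_indep_step`, `c025_ten_indep_from_1212`). Axioms: standard.
-/

namespace PercRepro

namespace ThmN

namespace Explicit

/-- **THE THEOREM-M KEY ROW AT `(q, p) = (10, 1 212)`**: `KeyL 10 1212 d` at every corank `11 ≤ d ≤ 1034`, by the kernel. -/
theorem key_ten_indep_row : ∀ t < 1024, KeyL 10 1212 (11 + t) := by decide +kernel

/-- **THE KEY'S OWN FLOOR IS `1 089`**: the THEOREM-M key FAILS at `p = 1 088`, corank `11`, by the kernel (the row sits at the tail `1 212`). -/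
theorem key_ten_indep_sharp : ¬ KeyL 10 1088 11 := by decide +kernel

end Explicit

end ThmN

end PercRepro
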